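/-
Copyright: H21 programme, solo seat `solo-RiemannHypothesis-informed` (session 6).
-/
import Summits.RiemannHypothesis.RiemannHypothesis.Theorems.SoloInformedCombWeight
import Summits.RiemannHypothesis.RiemannHypothesis.Theorems.SoloInformedEffSampling

/-!
# Summing a comb majorant over the zeros of `ζ` (solo-informed, T39e)

The zero-side counterpart of `SoloInformedCombWeight`: a function on the critical strip
majorised (off an exceptional finite set `S`) by `M · W_J(Im ρ - γ₀)`, where
`W_J(y) = ∑_{|n| ≤ J} 1/(1+(y+πn)²)` is the comb weight, has zero-sum

`∑_ρ m(ρ) F(ρ) ≤ 2 A₁ M (2J+1) log(|γ₀| + πJ + 2) + ∑_{ρ ∈ S} m(ρ) F(ρ)`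

(`finsum_weilZeroIndex_le_of_comb_bound`): split `F` along the partition of unity
`w(y+πn)/W_J(y)` and apply the single-kernel bound `finsum_weilZeroIndex_le_of_kernel_bound_eff`
tooth by tooth (`A₁ = zetaDensityConst`).  In particular the comb weight itself sums to
`≤ 2A₁(2J+1) log(|γ₀| + πJ + 2)` over any finite set of zeros (`sum_zeros_combWeight_le`).
-/

noncomputable section

open Real MeasureTheory Filter Complex Set Literature.NumberTheory.LFunctions
open scoped Topology ComplexConjugate

namespace Summit.RiemannHypothesis.RiemannHypothesis.Theorems

open Companion

namespace Companion

/-- `log(|γ₀ + t| + 2) ≤ log(|γ₀| + πJ + 2)` for `|t| ≤ πJ`. -/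
theorem log_abs_add_le {γ₀ t : ℝ} {J : ℕ} (ht : |t| ≤ π * J) :
    Real.log (|γ₀ + t| + 2) ≤ Real.log (|γ₀| + π * J + 2) := by
  apply Real.log_le_log (by positivity)
  have := abs_add_le γ₀ t
  linarith

/-- `|± tooth n| ≤ πJ` for `n < J`. -/
theorem abs_tooth_le {n J : ℕ} (hn : n < J) : |tooth n| ≤ π * J := by
  rw [abs_of_pos (tooth_pos n)]
  unfold tooth
  have : (n : ℝ) + 1 ≤ J := by exact_mod_cast hn
  nlinarith [Real.pi_pos]

/-- One tooth of the comb: the single-kernel bound recentred at `γ₀ - t`, for the piece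
`F ρ · w(Im ρ - γ₀ + t)/W_J(Im ρ - γ₀)` of a comb-majorised `F`. -/
theorem finsum_piece_le (F : ℂ → ℝ) {M : ℝ} (γ₀ t : ℝ) (J : ℕ) (hM : 0 ≤ M)
    (hmaj : ∀ ρ : ℂ, 0 ≤ ρ.re → ρ.re ≤ 1 → F ρ ≤ M * combWeight J (ρ.im - γ₀)) (T : ℝ) :
    ∑ᶠ ρ ∈ weilZeroIndex T, (riemannZetaZeroOrder ρ : ℝ) *
        (F ρ * (combw (ρ.im - γ₀ + t) / combWeight J (ρ.im - γ₀)))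
      ≤ 2 * zetaDensityConst * M * Real.log (|γ₀ - t| + 2) := by
  refine finsum_weilZeroIndex_le_of_kernel_bound_eff _ M (γ₀ - t) hM (fun ρ h0 h1 ↦ ?_) T
  have hW := combWeight_pos J (ρ.im - γ₀)
  have e : combw (ρ.im - γ₀ + t) = 1 / (1 + (ρ.im - (γ₀ - t)) ^ 2) := by
    unfold combw; ring
  calc F ρ * (combw (ρ.im - γ₀ + t) / combWeight J (ρ.im - γ₀))
      ≤ M * combWeight J (ρ.im - γ₀) * (combw (ρ.im - γ₀ + t) / combWeight J (ρ.im - γ₀)) :=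
        mul_le_mul_of_nonneg_right (hmaj ρ h0 h1) (div_nonneg (combw_pos _).le hW.le)
    _ = M / (1 + (ρ.im - (γ₀ - t)) ^ 2) := by rw [e]; field_simp

end Companion

/-- **T39e (comb majorant on the zero side).**  If `0 ≤ F ≤ M · W_J(Im ρ - γ₀)` on the
critical strip off a finite set `S` of points `≠ 1`, then for every `T`
`∑_{ρ ∈ Z_T} m(ρ) F(ρ) ≤ 2A₁ M (2J+1) log(|γ₀| + πJ + 2) + ∑_{ρ∈S} m(ρ) F(ρ)`. -/
theorem finsum_weilZeroIndex_le_of_comb_bound (F : ℂ → ℝ) {M : ℝ} (γ₀ : ℝ) (J : ℕ)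
    (S : Finset ℂ) (hM : 0 ≤ M) (hF : ∀ ρ, 0 ≤ F ρ) (hS1 : ∀ ρ ∈ S, ρ ≠ 1)
    (hmaj : ∀ ρ : ℂ, 0 ≤ ρ.re → ρ.re ≤ 1 → ρ ∉ S → F ρ ≤ M * combWeight J (ρ.im - γ₀))
    (T : ℝ) :
    ∑ᶠ ρ ∈ weilZeroIndex T, (riemannZetaZeroOrder ρ : ℝ) * F ρ
      ≤ 2 * zetaDensityConst * M * (2 * J + 1) * Real.log (|γ₀| + π * J + 2)
        + ∑ ρ ∈ S, (riemannZetaZeroOrder ρ : ℝ) * F ρ := by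
  classical
  set A₁ : ℝ := zetaDensityConst
  have hA₁ : 0 < A₁ := zetaDensityConst_pos
  set L : ℝ := Real.log (|γ₀| + π * J + 2) with hL
  have hfin := weilZeroIndex_finite T
  set Z : Finset ℂ := hfin.toFinset with hZ
  have hmZ : ∀ ρ ∈ Z, (0 : ℝ) ≤ riemannZetaZeroOrder ρ := fun ρ hρ ↦
    riemannZetaZeroOrder_nonneg_of_zero (hfin.mem_toFinset.mp hρ).1
  -- the function zeroed on `S`
  set F' : ℂ → ℝ := fun ρ ↦ if ρ ∈ S then 0 else F ρ with hF'
  have hF'0 : ∀ ρ, 0 ≤ F' ρ := fun ρ ↦ by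
    by_cases h : ρ ∈ S
    · simp only [hF', h, if_true]; exact le_rfl
    · simp only [hF', h, if_false]; exact hF ρ
  have hmaj' : ∀ ρ : ℂ, 0 ≤ ρ.re → ρ.re ≤ 1 → F' ρ ≤ M * combWeight J (ρ.im - γ₀) := by
    intro ρ h0 h1
    by_cases h : ρ ∈ S
    · simp only [hF', h, if_true]; exact mul_nonneg hM (combWeight_pos J _).le
    · simp only [hF', h, if_false]; exact hmaj ρ h0 h1 h
  -- step 1: `∑ m F ≤ ∑ m F' + ∑_S m F`
  have hsplit : ∑ ρ ∈ Z, (riemannZetaZeroOrder ρ : ℝ) * F ρ ≤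
      ∑ ρ ∈ Z, (riemannZetaZeroOrder ρ : ℝ) * F' ρ + ∑ ρ ∈ S, (riemannZetaZeroOrder ρ : ℝ) * F ρ := by
    have e : ∀ ρ ∈ Z, (riemannZetaZeroOrder ρ : ℝ) * F ρ =
        (riemannZetaZeroOrder ρ : ℝ) * F' ρ +
          (if ρ ∈ S then (riemannZetaZeroOrder ρ : ℝ) * F ρ else 0) := by
      intro ρ _
      by_cases h : ρ ∈ S
      · simp only [hF', h, if_true, mul_zero, zero_add]
      · simp only [hF', h, if_false, add_zero]
    rw [Finset.sum_congr rfl e, Finset.sum_add_distrib, ← Finset.sum_filter]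
    have hsub : Z.filter (fun ρ ↦ ρ ∈ S) ⊆ S := fun ρ hρ ↦ (Finset.mem_filter.mp hρ).2
    have hle : ∑ ρ ∈ Z.filter (fun ρ ↦ ρ ∈ S), (riemannZetaZeroOrder ρ : ℝ) * F ρ ≤
        ∑ ρ ∈ S, (riemannZetaZeroOrder ρ : ℝ) * F ρ :=
      Finset.sum_le_sum_of_subset_of_nonneg hsub fun ρ hρ _ ↦
        mul_nonneg (by exact_mod_cast riemannZetaZeroOrder_nonneg (hS1 ρ hρ)) (hF ρ)
    linarith
  -- step 2: partition of unity
  have hpou : ∀ y : ℝ, combw y / combWeight J y +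
      ∑ n ∈ Finset.range J, (combw (y + tooth n) / combWeight J y +
        combw (y - tooth n) / combWeight J y) = 1 := by
    intro y
    have hW := (combWeight_pos J y).ne'
    have e : combw y / combWeight J y +
        ∑ n ∈ Finset.range J, (combw (y + tooth n) / combWeight J y +
          combw (y - tooth n) / combWeight J y) =
        (combw y + ∑ n ∈ Finset.range J, (combw (y + tooth n) + combw (y - tooth n))) /
          combWeight J y := by
      simp_rw [add_div, Finset.sum_div, add_div]
    rw [e, show combw y + ∑ n ∈ Finset.range J, (combw (y + tooth n) + combw (y - tooth n)) =
      combWeight J y from rfl, div_self hW]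
  have hdecomp : ∀ ρ : ℂ, (riemannZetaZeroOrder ρ : ℝ) * F' ρ =
      (riemannZetaZeroOrder ρ : ℝ) * (F' ρ * (combw (ρ.im - γ₀ + 0) / combWeight J (ρ.im - γ₀))) +
      ∑ n ∈ Finset.range J,
        ((riemannZetaZeroOrder ρ : ℝ) *
            (F' ρ * (combw (ρ.im - γ₀ + tooth n) / combWeight J (ρ.im - γ₀))) +
          (riemannZetaZeroOrder ρ : ℝ) *
            (F' ρ * (combw (ρ.im - γ₀ - tooth n) / combWeight J (ρ.im - γ₀)))) := by
    intro ρ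
    have h := hpou (ρ.im - γ₀)
    rw [add_zero]
    conv_lhs => rw [← mul_one ((riemannZetaZeroOrder ρ : ℝ) * F' ρ), ← h]
    simp only [mul_add, Finset.mul_sum, mul_assoc]
  have hstep2 : ∑ ρ ∈ Z, (riemannZetaZeroOrder ρ : ℝ) * F' ρ ≤ 2 * A₁ * M * (2 * J + 1) * L := by
    rw [Finset.sum_congr rfl fun ρ _ ↦ hdecomp ρ, Finset.sum_add_distrib, Finset.sum_comm]
    simp_rw [Finset.sum_add_distrib]
    -- each piece via the single-kernel bound
    have hpiece : ∀ t : ℝ, |t| ≤ π * J →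
        ∑ ρ ∈ Z, (riemannZetaZeroOrder ρ : ℝ) *
            (F' ρ * (combw (ρ.im - γ₀ + t) / combWeight J (ρ.im - γ₀))) ≤ 2 * A₁ * M * L := by
      intro t ht
      have h := finsum_piece_le F' γ₀ t J hM hmaj' T
      rw [finsum_mem_eq_finite_toFinset_sum _ hfin] at h
      refine h.trans ?_
      have hlog : Real.log (|γ₀ - t| + 2) ≤ L := by
        rw [sub_eq_add_neg]; exact log_abs_add_le (by rwa [abs_neg])
      have : 0 ≤ 2 * A₁ * M := by positivity
      nlinarith
    have h0 := hpiece 0 (by rw [abs_zero]; positivity)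
    have hsum : ∑ n ∈ Finset.range J,
        (∑ ρ ∈ Z, (riemannZetaZeroOrder ρ : ℝ) *
            (F' ρ * (combw (ρ.im - γ₀ + tooth n) / combWeight J (ρ.im - γ₀))) +
          ∑ ρ ∈ Z, (riemannZetaZeroOrder ρ : ℝ) *
            (F' ρ * (combw (ρ.im - γ₀ - tooth n) / combWeight J (ρ.im - γ₀)))) ≤
        ∑ n ∈ Finset.range J, (2 * A₁ * M * L + 2 * A₁ * M * L) := by
      refine Finset.sum_le_sum fun n hn ↦ add_le_add ?_ ?_
      · exact hpiece _ (abs_tooth_le (Finset.mem_range.mp hn))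
      · have := hpiece (-tooth n) (by rw [abs_neg]; exact abs_tooth_le (Finset.mem_range.mp hn))
        simp only [← sub_eq_add_neg] at this
        exact this
    rw [Finset.sum_add_distrib, Finset.sum_const, Finset.card_range, nsmul_eq_mul] at hsum
    linarith
  rw [finsum_mem_eq_finite_toFinset_sum _ hfin]
  linarith

/-- **T39e′.**  The comb weight sums to `≤ 2A₁(2J+1) log(|γ₀| + πJ + 2)` over every finite set
of zeros of `ζ` in the critical strip off the real axis (counted with multiplicity). -/
theorem sum_zeros_combWeight_le (γ₀ : ℝ) (J : ℕ) (P : Finset ℂ)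
    (hP : ∀ ρ ∈ P, riemannZeta ρ = 0 ∧ 0 ≤ ρ.re ∧ ρ.re ≤ 1 ∧ ρ.im ≠ 0) :
    ∑ ρ ∈ P, (riemannZetaZeroOrder ρ : ℝ) * combWeight J (ρ.im - γ₀)
      ≤ 2 * zetaDensityConst * (2 * J + 1) * Real.log (|γ₀| + π * J + 2) := by
  classical
  set T : ℝ := ∑ ρ ∈ P, |ρ.im|
  have hfin := weilZeroIndex_finite T
  have hPT : P ⊆ hfin.toFinset := by
    intro ρ hρ
    obtain ⟨hz, h0, h1, him⟩ := hP ρ hρ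
    exact hfin.mem_toFinset.mpr ⟨hz, h0, h1, him,
      Finset.single_le_sum (fun ρ _ ↦ abs_nonneg (Complex.im ρ)) hρ⟩
  have h := finsum_weilZeroIndex_le_of_comb_bound (fun ρ ↦ combWeight J (ρ.im - γ₀)) γ₀ J ∅
    zero_le_one (fun ρ ↦ (combWeight_pos J _).le) (by simp) (fun ρ _ _ _ ↦ by rw [one_mul]) T
  rw [Finset.sum_empty, add_zero, mul_one, finsum_mem_eq_finite_toFinset_sum _ hfin] at h
  refine (Finset.sum_le_sum_of_subset_of_nonneg hPT fun ρ hρ _ ↦ ?_).trans h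
  exact mul_nonneg (riemannZetaZeroOrder_nonneg_of_zero (hfin.mem_toFinset.mp hρ).1)
    (combWeight_pos J _).le

end Summit.RiemannHypothesis.RiemannHypothesis.Theorems
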